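import Mathlib
import HarnessLib

/-!
# Gelbart–Rogawski 1991, §3.1: compatible splittings of the adelic metaplectic cover over a unitary
# group — Proposition 3.1.1 (p. 455) as ONE named fact over an abstract splitting datum, with the
# kernel corollaries its consumers use

Topic `NumberTheory/GelbartRogawski1991`; namespace `Literature.NumberTheory.GelbartRogawski1991`
(sibling of `WeilRepresentationsAPackets`, which records Thms 2.4.1 / 3.4 / 5.1.1 of the same paper
and explicitly leaves "the Weil representation itself" out).  Source: S. Gelbart, J. Rogawski,
*L-functions and Fourier–Jacobi coefficients for the unitary group `U(3)`*, Invent. Math. **105**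
(1991) 445–472 [GelbartRogawski1991], §3 "Global Weil representations", §3.1 "Compatible
splittings", pp. 454–457, read on the page images of the printed article (GDZ digitisation;
"p. N Lk" = printed page, approximate line).

## The printed text (verbatim)

p. 454 L21–33 (the objects): "Let `(W, φ)` be a symplectic space over `F` and let `H(W) = W ⊕ F` be
the associated Heisenberg group. As usual, the symplectic group `Sp(W)` acts as a group of
automorphisms of `H(W)`, fixing the center elementwise. For each non-trivial character `ψ`, let `ρ_ψ`
be an irreducible unitary representation of `H_𝐀(W)` with central character `ψ` (`ρ_ψ` is unique up
to isomorphism). We define the global metaplectic group `Mp_𝐀(W)` as the group of pairs `(g, M_g)`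
where `g ∈ Sp_𝐀(W)` and `M_g` is an operator on the space of `ρ_ψ` such that
`M_g ρ_ψ(h) M_g⁻¹ = ρ_ψ(g(h))` for all `h ∈ H(𝐀)`. The map `(g, M_g) → M_g` defines a unitary
representation of `Mp_𝐀(W)`, which we denote by `ω_ψ`. The projection `π((g, M_g)) = g` yields an
exact sequence `0 → ℂ* → Mp_𝐀(W) →π Sp_𝐀(W) → 0`."
p. 454 L40–42: "It is known ([We]) that `π` splits uniquely over the group of `F`-rational points
`Sp_F(W)`. We denote this splitting by `i`."  (`[We]` = A. Weil, Acta Math. 111 (1964) [Weil1964].)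
p. 454 L43–48: "Let `(V, Φ)` be a skew Hermitian space, where `V` is an `n`-dimensional vector space
over `E`. In this §, let `G` denote the unitary group attached to `(V, Φ)`. … Let `(W, φ)` be the
associated symplectic space over `F`. That is, `W` coincides with `V`, but viewed as an `F`-vector
space, and `φ = Tr_{E/F}(Φ)`."  (`E/F` "= quadratic extension of number fields", §1.1 p. 449.)
p. 455 L1–3: "**Proposition 3.1.1.** *The covering `π` splits over `G(𝐀)`. There exists a
continuous section `s : G(𝐀) → Mp_𝐀(W)` such that `s(G(F))` is contained in `i(Sp_F(W))`.*"
p. 457 L4–7: "*Remark.* A choice of splitting `s` as in the proposition will be called *compatible*.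
It is determined by the function `b(HK)` defined above. Thus, a choice of `s` is equivalent to a
choice of Hecke character of `E` whose restriction to `F` is `ω_{E/F}`, once `ψ` is fixed."
p. 457 L9–13 (for `G = U(3)`): "If `s*` is any other compatible splitting, then `s* = s ⊗ ν′`, where
`ν′` is an automorphic character of `E¹`, regarded as a character of `G` with values in the central
subgroup `ℂ*` of `Mp_𝐀(W)`".

## Transcription level — READ THIS

ONE printed statement is recorded as a named fact: `SplittingDatum.CompatibleSplitting D`
(= Prop. 3.1.1) is a predicate `def … : Prop` on an ABSTRACT `SplittingDatum` — the groups
`Sp ⊇ Sp_F(W)`, `Mp`, `G(𝐀) ⊇ G(F)` with the homomorphisms `π : Mp → Sp`, `ι : G(𝐀) → Sp` and the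
splitting `i : Sp_F(W) → Mp` of p. 454 as its fields (docstring of `SplittingDatum`), and topologies
on `G(𝐀)` and `Mp` as instance arguments — whose value at a datum reads LITERALLY "there exists a
continuous section `s : G(𝐀) → Mp_𝐀(W)` of `π` over `ι` [a homomorphism: "`π` splits over `G(𝐀)`"]
such that `s(G(F)) ⊆ i(Sp_F(W))`".  NOTHING IS ASSERTED: a consumer
instantiates the datum at ITS OWN constructed objects — the intended (and only legitimate)
instantiation is GR91's: `Sp := Sp_𝐀(W)` (or Weil's pseudosymplectic group of `H_𝐀(W)` containing
it), `Mp :=` the implementer group of pairs `(g, M_g)` over the constructed global `ψ`-representation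
`ρ_ψ` of `H_𝐀(W)`, `proj := π`, `GA := G(𝐀)` for `G = U(V, Φ)`, `toSp := ι_𝐀` (restriction of
scalars `E → F` on adelic points), `ratPts := G(F)`, `spRat := Sp_F(W)`, `ratSplit := i` — and takes
`(h : D.CompatibleSplitting)` as an explicit, cited hypothesis.  Object-match notes for that
instantiation: (a) GR91's `M_g` are operators on "the space of `ρ_ψ`"; an instance on the smooth
model `𝒮(X_𝐀)` (implementer pairs with `M ∈ Aut_ℂ 𝒮(X_𝐀)`) is the same dictionary row as
[Weil1964, n° 34–39] / [MoeglinVignerasWaldspurger1987, Chap. 2 II.1]; (b) GR91's `i` is THE splitting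
over `Sp_F(W)` (unique, p. 454 citing [We]); an instance whose `ratSplit` is the section whose
operators `ω_ψ ∘ i` fix the theta functional `Θ` is Weil's `r_F` ([Weil1964, n° 40–41, Théorèmes 4
and 6]: the operators of `r_F` fix `Θ`; two sections over `Sp_F(W)` whose operators fix `Θ` coincide
— `Θ`-rigidity of the instance, `Literature.GroupTheory.TwistedProduct.eq_ratLift_of_mem_fixer` in
cocycle coordinates), hence GR91's `i`; (c) a HERMITIAN
space `(V, h)` over `E` and the skew-Hermitian space `(V, δh)`, `δ ∈ E×` of trace zero, have the same
unitary group and `Tr_{E/F}(δh)` is the symplectic form used by the dual-pair files — Prop. 3.1.1 is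
applied to `(V, δh)`; (d) for a dual pair `U(V) × U(V′) ⊆ Sp(Res_{E/F}(V ⊗_E V′))` the proposition is
applied ONCE, to the unitary group `G₁ = U(V ⊗_E V′)` of the (skew-Hermitian) tensor product, and
restricted to the two commuting factors (`IsCompatible.pair` below); (e) "continuous": GR91 print NO topology on `Mp_𝐀(W)`; what is printed is (p. 454 L34–40,
verbatim) "*Let `∏′ Mp_v(W)` be the restricted direct product over all places `v` with respect to
the collection of subgroups `α_v(Sp(𝒪_v))`. There is a natural map from `∏′ Mp_v(W)` to `Mp_𝐀(W)`
with kernel `{(t_v) ∈ ∏′ Mp_v(W) : t_v ∈ ℂ*, ∏ t_v = 1}`.*"; "continuous" is read for the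
customary topology making that map a quotient map, i.e. Weil's topology on the adelic metaplectic
group `Mp(X)_A` [Weil1964, Chap. III n° 37–39], for which `π` is continuous and — verbatim, n° 39
p. 189 (held text
`paper:doi-10-1007-bf02391012` p0047 L21–23 and L48–50) — "*(S, Φ) → SΦ détermine une application
continue de Mp(X_A) × 𝒮(X_A) dans 𝒮(X_A)*" … "*S → SΦ est une application continue de Mp(X)_A
dans 𝒮(X_A), quelle que soit Φ ∈ 𝒮(X_A)*"; moreover Weil's operators are automorphisms of the
Schwartz–Bruhat space — verbatim, Chap. I n° 11 p. 158 (held text p0016 L21–23): "*Nous nous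
proposons de faire voir que tout `s ∈ 𝐁₀(G)` induit sur `𝒮(G)` un automorphisme de `𝒮(G)`; il
suffit pour cela de montrer que `s` induit sur `𝒮(G)` une application continue de `𝒮(G)` dans
lui-même*", and, n° 35 p. 186 (p0044 L16–17): "*il résulte des n° 11–12 du Chapitre I que, pour
tout `S ∈ Mp(X)`, l'automorphisme `Φ → SΦ` de `L²(X)` induit sur `𝒮(X)` un automorphisme de
`𝒮(X)`; par suite, `(S, Φ) → SΦ` détermine une application de `Mp(X) × 𝒮(X)` dans `𝒮(X)`;
nous allons voir maintenant que celle-ci est continue*" (the topology of `Mp(X)`: n° 34 p. 185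
L37–38 "*on le munira de la topologie induite par celle du groupe ambiant*" `Ps(X) × 𝐁₀(X)`; the
adelic case by n° 37–39).  Consequently the citation covers an instance
whose `Mp` is the group of pairs `(g, M_g)` of p. 454 with `M_g` CONTINUOUS for the Schwartz–Bruhat
(LF) topology of the Schrödinger space (the INTENDED instance: the subgroup of LF-continuous
implementers of the adelic Schrödinger representation — print's `s(g)` lies in it by the sentence
just quoted) and whose `[TopologicalSpace Mp]` is Weil's topology OR ANY COARSER ONE — the INTENDED
instance topology being the initial topology of `π` (into the adelic symplectic group) together
with the orbit maps `(g, M_g) ↦ M_g Φ` INTO the Schwartz–Bruhat space with its Schwartz–Bruhat (LF)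
topology: printed topology ≥ this initial topology because `π` and the orbit maps are continuous
in print (n° 39 as quoted), so a section continuous in the printed sense is continuous for the
instance — the record is WEAKER-OR-EQUAL than print, never stronger; an instance with a finer or
unrelated topology (discrete, indiscrete, …), or an `Mp` of operators NOT continuous on the
Schwartz–Bruhat space, is NOT covered.  This comparison is a docstring-level object match about
the instance, not a cited theorem.

NOT TRANSCRIBED: everything in the PROOF (pp. 455–457: the explicit cocycle and the function
`b_v(HK)` of (3.1.2) for `dim V = 2` quasi-split, `s_v(K_v) ⊂ α_v(Sp(𝒪_v))` for almost all `v`,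
(3.1.3), Kazhdan's splitting `[K₂]` over `H₀(𝐀) = SU(Φ_n ⊕ Φ₂)(𝐀)` — p. 456: "According to
`[K₂]`, there exists a splitting `s : H₀(𝐀) → Mp_𝐀(W)`", `[K₂]` = [Kazhdan1977] in the reference
list p. 472; NOT Kudla, whose explicit local splittings [Kudla1994, Thm. 3.1] post-date the paper —
and the diagram p. 456) — these are proof steps for special
cases, not statements about the `G` of the proposition.  CONSEQUENTLY the record pins a compatible
`s` only up to the twists
`s ↦ s·ν` by central-valued characters trivial on `G(F)` (the Remark p. 457, PROVED here in that
generality as `IsCompatible.exists_central_twist`, kernel) and pins NO local component of `s`; a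
consumer needing `s_∞|K_∞` or `s_v|K_v` explicitly must state its claims invariantly under such
twists or supply the local identification itself.

KERNEL (proved here, elementary, tagged `[folklore]`): `IsCompatible.proj_comp`,
`IsCompatible.apply_eq_ratSplit`, `CompatibleSplitting.exists_isCompatible` (the topology-free
consequence), `CompatibleSplitting.exists_hom_forall_mem` / `exists_hom_forall_map_mem` (if the
operators of `i` lie in a set `T` — e.g. the stabiliser of the theta functional, [Weil1964] Thm 4 /
Thm 6 — then so do the `s(γ)`, `γ ∈ G(F)`: the shape of the binders `s_cont`, `s_rat` of
`Literature.NumberTheory.Weil1964.ThetaKernelDatum.ofThetaMajorants`), `IsCompatible.pair` /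
`pair_mem` / `continuous_pair` (the pair splitting `G_U(𝐀) × G(𝐀) →* Mp` from one compatible
splitting of a group containing two commuting images, via `MonoidHom.noncommCoprod`),
`IsCompatible.exists_central_twist` (p. 457 Remark, "only if" direction, for any datum whose `ker π`
is central).

NOT here: the construction of any instance (the global `ψ`-representation, the implementer group and
its topology, the rational section — other files), the Weil representation `ω_ψ ∘ s` and its local
components, §3.2–§3.4, the uniqueness of `i` (p. 454 "[We]") — not needed to STATE 3.1.1 once `i` is
a field.

## References

* S. Gelbart, J. Rogawski, Invent. Math. 105 (1991) 445–472, doi 10.1007/BF01232276, §3.1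
  pp. 454–457. [GelbartRogawski1991]
* A. Weil, *Sur certains groupes d'opérateurs unitaires*, Acta Math. 111 (1964) 143–211, n° 40–41.
  [Weil1964]
* D. Kazhdan, *Some applications of the Weil representation*, J. Analyse Math. 32 (1977) 235–248,
  doi 10.1007/BF02803582 — the `[K₂]` of p. 456 / p. 472 (splitting over `SU` used in the proof for
  general `n`; provenance only, nothing of it is transcribed). [Kazhdan1977]
* S. S. Kudla, *Splitting metaplectic covers of dual reductive pairs*, Israel J. Math. 87 (1994)
  361–401 — the later explicit LOCAL splittings over unitary groups (`F` local, `F ≠ ℂ`); not cited by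
  the paper; named here only to prevent the confusion with `[K₂]`. [Kudla1994]
* C. Moeglin, M.-F. Vignéras, J.-L. Waldspurger, LNM 1291 (1987), Chap. 2 II.1.
  [MoeglinVignerasWaldspurger1987]
-/

namespace Literature.NumberTheory.GelbartRogawski1991

universe u v w u₁ u₂ u₃

/-- **The standing data of [GelbartRogawski1991, §3.1, p. 454]** over which Proposition 3.1.1 is
stated, ABSTRACTLY (types and homomorphisms only; intended instantiation in brackets):
* `Sp` ["`Sp_𝐀(W)`", the adelic symplectic group of `W = Res_{E/F} V`, `φ = Tr_{E/F}(Φ)` — or any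
  group containing it through which it acts on `H_𝐀(W)`], `Mp` ["the global metaplectic group
  `Mp_𝐀(W)` … the group of pairs `(g, M_g)` where `g ∈ Sp_𝐀(W)` and `M_g` is an operator on the
  space of `ρ_ψ` such that `M_g ρ_ψ(h) M_g⁻¹ = ρ_ψ(g(h))` for all `h ∈ H(𝐀)`"], `GA` ["`G(𝐀)`",
  `G` "the unitary group attached to `(V, Φ)`", `(V, Φ)` skew Hermitian of dimension `n` over `E`];
* `proj` ["The projection `π((g, M_g)) = g`"]; `toSp` [`G(𝐀) → Sp_𝐀(W)`: "`W` coincides with `V`,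
  but viewed as an `F`-vector space"]; `ratPts` [`G(F) ⊆ G(𝐀)`]; `spRat` ["the group of `F`-rational
  points `Sp_F(W)`"]; `toSp_mem_spRat` [`G(F) ⊆ Sp_F(W)`]; `ratSplit` with `proj_ratSplit` ["`π`
  splits uniquely over the group of `F`-rational points `Sp_F(W)`. We denote this splitting by `i`."
  — the field is A splitting `i` of `π` over `Sp_F(W)`; see the module docstring, object-match (b)].
[cite: GelbartRogawski1991, §3.1, p. 454 L21–48] -/
structure SplittingDatum (Sp : Type u) (Mp : Type v) (GA : Type w) [Group Sp] [Group Mp] [Group GA]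
    where
  /-- `π : Mp_𝐀(W) → Sp_𝐀(W)`, `(g, M_g) ↦ g`. -/
  proj : Mp →* Sp
  /-- `ι : G(𝐀) → Sp_𝐀(W)` (restriction of scalars `E → F`). -/
  toSp : GA →* Sp
  /-- `G(F) ⊆ G(𝐀)`. -/
  ratPts : Subgroup GA
  /-- `Sp_F(W) ⊆ Sp_𝐀(W)`. -/
  spRat : Subgroup Sp
  /-- `ι(G(F)) ⊆ Sp_F(W)`. -/
  toSp_mem_spRat : ∀ γ ∈ ratPts, toSp γ ∈ spRat
  /-- the splitting `i : Sp_F(W) → Mp_𝐀(W)` of `π` over the rational points. -/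
  ratSplit : spRat →* Mp
  /-- `π ∘ i = ` the inclusion `Sp_F(W) ⊆ Sp_𝐀(W)`. -/
  proj_ratSplit : ∀ x : spRat, proj (ratSplit x) = (x : Sp)

namespace SplittingDatum

variable {Sp : Type u} {Mp : Type v} {GA : Type w} [Group Sp] [Group Mp] [Group GA]
variable (D : SplittingDatum Sp Mp GA)

/-- "A choice of splitting `s` as in the proposition will be called *compatible*" (p. 457 L4):
`s : G(𝐀) → Mp_𝐀(W)` is a homomorphic section of `π` over `ι` ("`π` splits over `G(𝐀)`") with
"`s(G(F))` … contained in `i(Sp_F(W))`".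
[cite: GelbartRogawski1991, §3.1 Prop. 3.1.1 p. 455 L1–3; Remark p. 457 L4] -/
def IsCompatible (s : GA →* Mp) : Prop :=
  (∀ g : GA, D.proj (s g) = D.toSp g) ∧ ∀ γ ∈ D.ratPts, s γ ∈ D.ratSplit.range

/-- **[GelbartRogawski1991, Proposition 3.1.1, p. 455]** (verbatim): "*The covering `π` splits over
`G(𝐀)`. There exists a continuous section `s : G(𝐀) → Mp_𝐀(W)` such that `s(G(F))` is contained in
`i(Sp_F(W))`.*" — there is a continuous homomorphism `s : G(𝐀) →* Mp_𝐀(W)` with `π ∘ s = ι` and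
`s(G(F)) ⊆ i(Sp_F(W))`, for the topology of the adelic points on `G(𝐀)` and, on `Mp`, the
customary (Weil) topology of `Mp_𝐀(W)` or a coarser one (module docstring, object-match (e)).  A
NAMED FACT: used only as a
hypothesis `(h : D.CompatibleSplitting)` at the instantiation described in the module docstring;
never proved or asserted here.
[cite: GelbartRogawski1991, §3.1 Proposition 3.1.1, p. 455 L1–3] -/
def CompatibleSplitting [TopologicalSpace GA] [TopologicalSpace Mp] : Prop :=
  ∃ s : GA →* Mp, Continuous s ∧ D.IsCompatible s

variable {D}

/-! ## Kernel corollaries -/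

/-- a compatible `s` is a section of `π` over `ι`: `π ∘ s = ι`. [folklore] -/
theorem IsCompatible.proj_comp {s : GA →* Mp} (hs : D.IsCompatible s) : D.proj.comp s = D.toSp :=
  MonoidHom.ext hs.1

/-- a compatible `s` carries `G(F)` into `i(Sp_F(W))`; explicitly `s γ = i (ι γ)`. [folklore] -/
theorem IsCompatible.apply_eq_ratSplit {s : GA →* Mp} (hs : D.IsCompatible s) {γ : GA}
    (hγ : γ ∈ D.ratPts) :
    s γ = D.ratSplit ⟨D.toSp γ, D.toSp_mem_spRat γ hγ⟩ := by
  obtain ⟨x, hx⟩ := hs.2 γ hγ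
  have hxg : (x : Sp) = D.toSp γ := by
    rw [← D.proj_ratSplit x, hx, hs.1 γ]
  have : x = ⟨D.toSp γ, D.toSp_mem_spRat γ hγ⟩ := Subtype.ext hxg
  rw [← hx, this]

/-- membership of `s(γ)`, `γ ∈ G(F)`, in any set containing `i(Sp_F(W))`. [folklore] -/
theorem IsCompatible.mem_of_forall_ratSplit_mem {s : GA →* Mp} (hs : D.IsCompatible s) {T : Set Mp}
    (hT : ∀ x : D.spRat, D.ratSplit x ∈ T) {γ : GA} (hγ : γ ∈ D.ratPts) : s γ ∈ T := by
  obtain ⟨x, hx⟩ := hs.2 γ hγ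
  rw [← hx]
  exact hT x

section Topology

variable [TopologicalSpace GA] [TopologicalSpace Mp]

/-- the topology-free content of Prop. 3.1.1: a compatible splitting exists. [folklore] -/
theorem CompatibleSplitting.exists_isCompatible (h : D.CompatibleSplitting) :
    ∃ s : GA →* Mp, D.IsCompatible s := by
  obtain ⟨s, -, hs⟩ := h
  exact ⟨s, hs⟩

/-- **If the operators of `i` lie in `T`, so do the `s(γ)`, `γ ∈ G(F)`.**  With `T` the set of
elements of `Mp_𝐀(W)` whose operator `ω_ψ(·)` fixes the theta functional ([Weil1964] Thm 4 for
`i = r_F`), this is the pair of binders `s_cont`, `s_rat` of the theta-kernel files for the splitting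
delivered by Prop. 3.1.1. [folklore] -/
theorem CompatibleSplitting.exists_hom_forall_mem (h : D.CompatibleSplitting) {T : Set Mp}
    (hT : ∀ x : D.spRat, D.ratSplit x ∈ T) :
    ∃ s : GA →* Mp, Continuous s ∧ (∀ g : GA, D.proj (s g) = D.toSp g) ∧
      ∀ γ ∈ D.ratPts, s γ ∈ T := by
  obtain ⟨s, hsc, hs⟩ := h
  exact ⟨s, hsc, hs.1, fun γ hγ => hs.mem_of_forall_ratSplit_mem hT hγ⟩

/-- the same through any homomorphism `ω` out of `Mp` (e.g. `ω_ψ : (g, M_g) ↦ M_g` into the operators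
of the space of `ρ_ψ`, and `T′` a stabiliser there). [folklore] -/
theorem CompatibleSplitting.exists_hom_forall_map_mem (h : D.CompatibleSplitting) {M : Type u₁}
    [Monoid M] (ω : Mp →* M) {T' : Set M} (hT : ∀ x : D.spRat, ω (D.ratSplit x) ∈ T') :
    ∃ s : GA →* Mp, Continuous s ∧ (∀ g : GA, D.proj (s g) = D.toSp g) ∧
      ∀ γ ∈ D.ratPts, ω (s γ) ∈ T' :=
  h.exists_hom_forall_mem (T := ω ⁻¹' T') hT

end Topology

section Pair

variable {GU : Type u₂} {G : Type u₃} [Group GU] [Group G]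

/-- **The pair splitting.**  One compatible splitting `s` of a group `G₁(𝐀)` (Prop. 3.1.1 for the
unitary group `G₁ = U(V ⊗_E V′)` of a dual pair `U(V) × U(V′)`) restricted along two homomorphisms
`a : G_U(𝐀) → G₁(𝐀)`, `b : G(𝐀) → G₁(𝐀)` with commuting images is a homomorphism
`(x, y) ↦ s(a x) s(b y)` on the product, over `ι ∘ (a·b)`, carrying `Γ_U × Γ` into `i(Sp_F(W))` when
`a(Γ_U), b(Γ) ⊆ G₁(F)` — the binders `s`, `s_rat` of
`Literature.NumberTheory.Weil1964.ThetaKernelDatum.ofThetaMajorants`. [folklore] -/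
theorem IsCompatible.pair {s : GA →* Mp} (hs : D.IsCompatible s) (a : GU →* GA) (b : G →* GA)
    (hab : ∀ (x : GU) (y : G), Commute (a x) (b y)) {ΓU : Subgroup GU} {Γ : Subgroup G}
    (ha : ∀ γ ∈ ΓU, a γ ∈ D.ratPts) (hb : ∀ γ ∈ Γ, b γ ∈ D.ratPts) :
    (∀ p : GU × G, D.proj (s.comp (MonoidHom.noncommCoprod a b hab) p) = D.toSp (a p.1 * b p.2)) ∧
      ∀ γU ∈ ΓU, ∀ γ ∈ Γ, s.comp (MonoidHom.noncommCoprod a b hab) (γU, γ) ∈ D.ratSplit.range := by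
  refine ⟨fun p => ?_, fun γU hγU γ hγ => ?_⟩
  · rw [MonoidHom.comp_apply, MonoidHom.noncommCoprod_apply, hs.1]
  · rw [MonoidHom.comp_apply, MonoidHom.noncommCoprod_apply, map_mul]
    exact D.ratSplit.range.mul_mem (hs.2 _ (ha γU hγU)) (hs.2 _ (hb γ hγ))

/-- the pair splitting with target set `T ⊇ i(Sp_F(W))` closed under multiplication (a stabiliser):
`s(a γ_U) s(b γ) ∈ T`. [folklore] -/
theorem IsCompatible.pair_mem {s : GA →* Mp} (hs : D.IsCompatible s) (a : GU →* GA) (b : G →* GA)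
    (hab : ∀ (x : GU) (y : G), Commute (a x) (b y)) {ΓU : Subgroup GU} {Γ : Subgroup G}
    (ha : ∀ γ ∈ ΓU, a γ ∈ D.ratPts) (hb : ∀ γ ∈ Γ, b γ ∈ D.ratPts) {T : Submonoid Mp}
    (hT : ∀ x : D.spRat, D.ratSplit x ∈ T) :
    ∀ γU ∈ ΓU, ∀ γ ∈ Γ, s.comp (MonoidHom.noncommCoprod a b hab) (γU, γ) ∈ T := by
  intro γU hγU γ hγ
  obtain ⟨x, hx⟩ := (hs.pair a b hab ha hb).2 γU hγU γ hγ
  rw [← hx]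
  exact hT x

/-- the pair splitting is continuous when `s`, `a`, `b` are and the multiplication of `G₁(𝐀)`
(`GA`, a topological group of adelic points) is continuous — NO continuity of the multiplication
of `Mp` is needed (the binder `s_cont` of the theta-kernel files). [folklore] -/
theorem continuous_pair [TopologicalSpace GA] [ContinuousMul GA] [TopologicalSpace Mp]
    [TopologicalSpace GU] [TopologicalSpace G] {s : GA →* Mp} (hsc : Continuous s) {a : GU →* GA}
    {b : G →* GA} (hac : Continuous a) (hbc : Continuous b)
    (hab : ∀ (x : GU) (y : G), Commute (a x) (b y)) :
    Continuous (s.comp (MonoidHom.noncommCoprod a b hab)) := by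
  have : (fun p : GU × G => s (a p.1 * b p.2)) = s.comp (MonoidHom.noncommCoprod a b hab) := by
    funext p
    rw [MonoidHom.comp_apply, MonoidHom.noncommCoprod_apply]
  rw [← this]
  exact hsc.comp ((hac.comp continuous_fst).mul (hbc.comp continuous_snd))

end Pair

section Twist

/-- **[GelbartRogawski1991, Remark p. 457]** ("If `s*` is any other compatible splitting, then
`s* = s ⊗ ν′`, where `ν′` is an automorphic character … with values in the central subgroup `ℂ*` of
`Mp_𝐀(W)`"), the "only if" direction, KERNEL for any datum whose `ker π` is central: two compatible
splittings differ by a homomorphism `ν : G(𝐀) → ker π` that is trivial on `G(F)`. [folklore] -/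
theorem IsCompatible.exists_central_twist (hker : ∀ m : Mp, D.proj m = 1 → m ∈ Subgroup.center Mp)
    {s s' : GA →* Mp} (hs : D.IsCompatible s) (hs' : D.IsCompatible s') :
    ∃ ν : GA →* Mp, (∀ g : GA, D.proj (ν g) = 1) ∧ (∀ g : GA, s' g = s g * ν g) ∧
      ∀ γ ∈ D.ratPts, ν γ = 1 := by
  have hproj : ∀ g : GA, D.proj ((s g)⁻¹ * s' g) = 1 := fun g => by
    rw [map_mul, map_inv, hs.1, hs'.1, inv_mul_cancel]
  have hcomm : ∀ (g : GA) (m : Mp), m * ((s g)⁻¹ * s' g) = (s g)⁻¹ * s' g * m := fun g m =>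
    (Subgroup.mem_center_iff.1 (hker _ (hproj g)) m)
  let ν : GA →* Mp := MonoidHom.mk' (fun g => (s g)⁻¹ * s' g) fun g g' => by
    simp only [map_mul, mul_inv_rev]
    calc (s g')⁻¹ * (s g)⁻¹ * (s' g * s' g')
        = (s g')⁻¹ * ((s g)⁻¹ * s' g) * s' g' := by group
      _ = (s g)⁻¹ * s' g * (s g')⁻¹ * s' g' := by rw [hcomm g (s g')⁻¹]
      _ = (s g)⁻¹ * s' g * ((s g')⁻¹ * s' g') := by group
  refine ⟨ν, hproj, fun g => ?_, fun γ hγ => ?_⟩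
  · show s' g = s g * ((s g)⁻¹ * s' g)
    rw [mul_inv_cancel_left]
  · show (s γ)⁻¹ * s' γ = 1
    obtain ⟨x, hx⟩ := hs.2 γ hγ
    obtain ⟨y, hy⟩ := hs'.2 γ hγ
    have hxy : x = y := by
      apply Subtype.ext
      rw [← D.proj_ratSplit x, ← D.proj_ratSplit y, hx, hy, hs.1, hs'.1]
    rw [← hx, ← hy, hxy, inv_mul_cancel]

end Twist

end SplittingDatum

end Literature.NumberTheory.GelbartRogawski1991
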